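import Summits.ValiantsHypothesis.ValiantsHypothesis.Theorems.DivisionGapSquareGridDimersDivisionEasyWitness

/-!
# `SquareGridDimersDivisionEasy` (route DivisionGap, item stmt-ValiantsHypothesis-5072): proof

The domino (perfect-matching) polynomial `D_N` of the `N × N` square grid, in the item's encoding
(fixed-point-free adjacent involutions, doubled edge variables, coefficients in `ℝ≥0`), has polynomial
division complexity: for every `N` there is a nonzero `h` with `L(D_N · h) + L(h) ≤ N ^ 11 + 11`, where
`L` is the tree's monotone circuit size `complexity` over `ℝ≥0`.  For odd `N`, `D_N = 0`; `D_0 = 1`;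
for `N = 2k+2` run Propp's generalized domino shuffling (2003, §2) on the Aztec diamond of order `2k+1`
carrying the grid (weights `X_(u,v) X_(v,u)` on grid edges, `1` inside the corners, `0` on the crossing
edges): `h = (#corner matchings) · Den`, `D_N · h = Num`, where `Num`, `Den` are the layered
numerator/denominator polynomials at the initial valuation, of circuit size `O(N³)`; no cell factor
vanishes by the positivity invariant, and `Num = D_N · h` is read off in the fraction field of the real
polynomials, where `ℝ≥0[X]` embeds. [cite: Propp2003, §2]
-/

namespace Summit.ValiantsHypothesis.ValiantsHypothesis.Theorems

namespace SquareGridDimers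

set_option linter.dupNamespace false

noncomputable section

open Finset

/-! ## Assembly -/

section Assembly

open Literature.Computability.AlgebraicComplexity
open scoped NNReal

variable (kk : ℕ)

/-- **The even case of the item** with the explicit bound `150 n³`, `n = 2k+1`. [cite: Propp2003, §2] -/
theorem even_case : ∃ h : PN kk, h ≠ 0 ∧
    complexity (sqPoly (2 * kk + 2) * h) + complexity h ≤ 150 * (2 * kk + 1) ^ 3 := by
  obtain ⟨hnum, hne⟩ := num_eq_and_hP_ne_zero kk
  refine ⟨hP kk, hne, ?_⟩
  rw [sqPoly_eq_sqSum, ← hnum]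
  have h1 := complexity_aeval_s0_le kk true
  have h2 := complexity_aeval_s0_le kk false
  have h3 : complexity (hP kk) ≤ complexity (Den kk) + 1 := by
    unfold hP
    calc _ ≤ complexity (((pmSet (G kk)ᶜ).card : PN kk)) + complexity (Den kk) + 1 := complexity_mul_le_holds _ _
      _ = complexity (Den kk) + 1 := by
          rw [show ((pmSet (G kk)ᶜ).card : PN kk) = MvPolynomial.C (((pmSet (G kk)ᶜ).card : ℝ≥0)) from
            (map_natCast MvPolynomial.C _).symm, complexity_C_holds, zero_add]
  unfold Num at h1 ⊢
  unfold Den at h2 h3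
  have h4 : 1 ≤ (2 * kk + 1) ^ 2 := Nat.one_le_pow _ _ (by omega)
  have h5 : (2 * kk + 1) ^ 2 ≤ (2 * kk + 1) ^ 3 := Nat.pow_le_pow_right (by omega) (by omega)
  linarith

/-- **The item's clause for every `N`, with `c = 11`.** [cite: Propp2003, §2] -/
theorem clause (N : ℕ) : ∃ h : MvPolynomial ((Fin N × Fin N) × (Fin N × Fin N)) ℝ≥0,
    h ≠ 0 ∧ complexity (sqPoly N * h) + complexity h ≤ N ^ 11 + 11 := by
  rcases Nat.even_or_odd N with hN | hN
  · rcases N with _ | N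
    · refine ⟨1, one_ne_zero, ?_⟩
      rw [sqPoly_zero, one_mul]
      have : complexity (1 : MvPolynomial ((Fin 0 × Fin 0) × (Fin 0 × Fin 0)) ℝ≥0) = 0 := by
        simpa using complexity_C_holds (σ := (Fin 0 × Fin 0) × (Fin 0 × Fin 0)) (1 : ℝ≥0)
      rw [this]; omega
    · obtain ⟨kk, hkk⟩ : ∃ kk, N + 1 = 2 * kk + 2 := by
        obtain ⟨r, hr⟩ := hN; exact ⟨r - 1, by omega⟩
      rw [hkk]
      obtain ⟨h, hne, hle⟩ := even_case kk
      refine ⟨h, hne, hle.trans ?_⟩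
      have h1 : (2 * kk + 1) ^ 3 ≤ (2 * kk + 2) ^ 3 := Nat.pow_le_pow_left (by omega) 3
      have h2 : 150 * (2 * kk + 2) ^ 3 ≤ (2 * kk + 2) ^ 11 := by
        have : 150 ≤ (2 * kk + 2) ^ 8 := by
          calc 150 ≤ 2 ^ 8 := by norm_num
            _ ≤ (2 * kk + 2) ^ 8 := Nat.pow_le_pow_left (by omega) 8
        calc 150 * (2 * kk + 2) ^ 3 ≤ (2 * kk + 2) ^ 8 * (2 * kk + 2) ^ 3 := Nat.mul_le_mul_right _ this
          _ = (2 * kk + 2) ^ 11 := by ring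
      omega
  · refine ⟨1, one_ne_zero, ?_⟩
    rw [sqPoly_eq_zero_of_odd hN, zero_mul]
    have h0 : complexity (0 : MvPolynomial ((Fin N × Fin N) × (Fin N × Fin N)) ℝ≥0) = 0 := by
      simpa using complexity_C_holds (σ := (Fin N × Fin N) × (Fin N × Fin N)) (0 : ℝ≥0)
    have h1 : complexity (1 : MvPolynomial ((Fin N × Fin N) × (Fin N × Fin N)) ℝ≥0) = 0 := by
      simpa using complexity_C_holds (σ := (Fin N × Fin N) × (Fin N × Fin N)) (1 : ℝ≥0)
    rw [h0, h1]; omega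

end Assembly

end

end SquareGridDimers

/-- **`SquareGridDimersDivisionEasy` holds** (route DivisionGap, item stmt-ValiantsHypothesis-5072):
the domino polynomial of the `n × n` square grid has polynomial division complexity — for every `n`
there is a nonzero monotone `h` (here: a positive integer times the accumulated denominator of Propp's
generalized domino-shuffling algorithm run on the Aztec diamond of order `n - 1` carrying the grid)
with `L₊(D_n · h) + L₊(h) ≤ n ^ 11 + 11`. [cite: Propp2003, §2] -/
theorem squareGridDimersDivisionEasy_proof :
    Summit.ValiantsHypothesis.ValiantsHypothesis.Theses.DivisionGap.SquareGridDimersDivisionEasy :=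
  SquareGridDimers.item_iff.mpr ⟨11, SquareGridDimers.clause⟩

end Summit.ValiantsHypothesis.ValiantsHypothesis.Theorems
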